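import Summits.BirchSwinnertonDyer.BirchSwinnertonDyer.Theorems.MordellShaFreeCutKatoBDPReciprocity
import Summits.BirchSwinnertonDyer.BirchSwinnertonDyer.Theorems.MordellShaFreeCutKatoZetaRoadFactsCensus
import Summits.BirchSwinnertonDyer.BirchSwinnertonDyer.Theorems.MordellShaFreeCutThreeAdicBDPValueReciprocity
import Literature.NumberTheory.EllipticCurves.Kato2004.IwasawaCohomologyExistsProofs
import Literature.NumberTheory.EllipticCurves.Kato2004.LocPKernelRankOneProofs
import HarnessLib

set_option linter.dupNamespace false
set_option autoImplicit false

/-! # Route `MordellShaFreeCut` (rung S2b) — WHERE THE TWO ROADS TO CRUX B MEET: crux B from the kato-zeta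
road's citation-borne facts + the BDP road's element-with-value EV∃ + the Kato ↔ BDP reciprocity (ERL₃) —
(LB-wan) is NOT needed on this path

Cell `bsd-cn100`, prover seat `bsd-cn100-s2b-c3` (g8). Supports, does not close, stmt-BirchSwinnertonDyer-19160 (crux B
`AnalyticRankOneOfRankOneFiniteShaThree`). THEOREMS ONLY (one-line compositions of landed censuses; 0 def, 0 fact).

The S2b BDP road reads crux B ⟸ EV∃ + **(LB-wan)** + six refereed facts (`cruxB_of_bdpExistsValue`, p478070); its
weakest link is (LB-wan) `ThreeAdicWanDivisibility` (an Eisenstein-direction main-conjecture divisibility with no printed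
mechanism at `3 ∣ N`, `E_D[3]` reducible — plan g16 RULING-1 (2)). The kato-zeta road (registered line on 19160, v1e)
reads crux B ⟸ nine citation-borne facts + two tree theorems + **`PRFormulaAtThreeH2`** (p472508 / p487347-twin), and
`MordellShaFreeCutKatoBDPReciprocity.prFormulaAtThreeH2_of_bdpExistsValue_of_reciprocity` (this seat, p488113) proves
`PRFormulaAtThreeH2 ⟸ EV∃ ∧ (ERL₃)`. COMPOSING: **crux B ⟸ EV∃ + (ERL₃) + {six refereed theorems, three reading-grade
Kato facts}** — the BDP road's (LB-wan) is TRADED for the explicit reciprocity (ERL₃) plus Kato's Euler-system readings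
(which are print). With the descent reduction (p486913/p487394: EV∃'s existence half ⟸ (T1) + Tate–Sen +
`ThreeAdicBDPValueReciprocity`) the fully decomposed end state of S2b's crux B is:
  crux B ⟸ {six refereed theorems, `nonempty_iwasawaH2Data`, `thm12_4`, `finite_descentCokernel_of_rankOne`, (T1)
  `Hsieh2014.thmA_exists_isHsiehLFunction_unrPeriod_anyLevel`, Tate–Sen `TateSenCharacterVanishing 3`} [ALL citation-borne /
  printed] + {`ThreeAdicBDPValueReciprocity` [archimedean reciprocity, print-derivable shape], (LB-bdp) ∀-frame
  `ThreeAdicBDPValueAtOne` [value formula at 𝟙; WRITTEN, MEMO-13 twin], (ERL₃) `ThreeAdicKatoBDPReciprocity` [OPEN research]}.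
* `cruxB_of_namedFacts_of_bdpExistsValue_of_reciprocity` — crux B ⟸ nine named facts + EV∃ + (ERL₃) (conj 7/11 of the old
  bundle fed by the tree theorems `nonempty_iwasawaH1Data_holds` / `locP_kernel_isTorsion_of_rankOne_holds`).
* `cruxB_of_refereedInputs_of_bdpExistsValue_of_reciprocity` — the same over the registered v1e 9-conjunct bundle
  `stub_refereedInputs` TOKEN FOR TOKEN (so the kato-zeta line closes from {RI, EV∃, (ERL₃)}).
* `cruxB_of_namedFacts_of_tateSen_of_valueReciprocity_of_value_of_reciprocity` — the fully decomposed end state above.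
HONEST FRAMING: CONDITIONAL one-line compositions; nothing here proves EV∃, (ERL₃), the value formula, the reciprocity
clause, crux B, the leaf, Sylvester's conjecture or any case of BSD; T and crux B exactly as open as before. PARTITION:
none — RANK axis.
[cite: AlpogeBhargavaShnidman2022, App. A Thm. 10.1, Thm. 10.8 (pp. 33–34) (the kato-zeta road)]
[cite: CastellaGrossiLeeSkinner2022, §5.2 (the BDP road)] [cite: Kato2004Asterisque, Thm. 12.4, (14.9.3), §14.14] -/

noncomputable section

open scoped Classical

namespace Summit.BirchSwinnertonDyer.BirchSwinnertonDyer.Theorems.MordellShaFreeCutRoadsMeetCensus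

open WeierstrassCurve NumberField IsDedekindDomain Field Literature.NumberTheory.EllipticCurves
  Literature.NumberTheory.EllipticCurves.ModularForms Literature.NumberTheory.EllipticCurves.Kato2004
  Literature.NumberTheory.GaloisRepresentations
open Literature.NumberTheory.PAdicHodge (TateSenCharacterVanishing)
open Summit.BirchSwinnertonDyer.BirchSwinnertonDyer.Theses.MordellShaFreeCut (AnalyticRankOneOfRankOneFiniteShaThree)
open Summit.BirchSwinnertonDyer.BirchSwinnertonDyer.Theorems.MordellShaFreeCutThreeAdicBDPExistsValue
  (ThreeAdicBDPElementExistsWithValue)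
open Summit.BirchSwinnertonDyer.BirchSwinnertonDyer.Theorems.MordellShaFreeCutThreeAdicBDPTriple (ThreeAdicBDPValueAtOne)
open Summit.BirchSwinnertonDyer.BirchSwinnertonDyer.Theorems.MordellShaFreeCutKatoBDPReciprocity
  (ThreeAdicKatoBDPReciprocity prFormulaAtThreeH2_of_bdpExistsValue_of_reciprocity)
open Summit.BirchSwinnertonDyer.BirchSwinnertonDyer.Theorems.MordellShaFreeCutKatoZetaRoadFactsCensus
  (cruxB_of_namedFacts_of_prFormulaH2)
open Summit.BirchSwinnertonDyer.BirchSwinnertonDyer.Theorems.MordellShaFreeCutThreeAdicBDPValueReciprocity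
  (ThreeAdicBDPValueReciprocity threeAdicHsiehDescent_of_tateSenCharacter_of_valueReciprocity)
open Summit.BirchSwinnertonDyer.BirchSwinnertonDyer.Theorems.MordellShaFreeCutThreeAdicHsiehDescent
  (bdpExistsWithValue_of_anyLevel_of_descent_of_value)

/-- **Crux B from nine named facts + EV∃ + (ERL₃) — the two roads MEET; (LB-wan) is not used.** Six refereed theorems
(`3`-parity, modularity, Hoffstein–Luo, Kato finiteness, Heegner points, Gross–Zagier + Kolyvagin), three reading-grade
typed Kato facts (`nonempty_iwasawaH2Data`, `thm12_4`, `finite_descentCokernel_of_rankOne`; the former conjuncts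
`nonempty_iwasawaH1Data` / `locP_kernel_isTorsion_of_rankOne` are the TREE THEOREMS `…_holds`), the BDP element with its
value at 𝟙 (`hEV`, the registered EV∃ stub of stmt-19159) and the Kato ↔ BDP reciprocity (`hERL`, OPEN) give crux B:
`cruxB_of_namedFacts_of_prFormulaH2` (p472508) ∘ `prFormulaAtThreeH2_of_bdpExistsValue_of_reciprocity` (p488113).
CONDITIONAL; closes nothing. [cite: AlpogeBhargavaShnidman2022, App. A Thm. 10.1 and Thm. 10.8 (pp. 33–34)]
[cite: Kato2004Asterisque, Thm. 12.4 (p. 221), (14.9.3) (p. 240), §14.14 (p. 243)] -/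
theorem cruxB_of_namedFacts_of_bdpExistsValue_of_reciprocity
    (hpar : ∀ (W : WeierstrassCurve ℚ) [W.IsElliptic] (p : ℕ) [Fact p.Prime], p_parity W p)
    (hmod : ModularForms.exists_isNewformOf) (hHL : HoffsteinLuo1997_exists_twist_L_one_ne_zero)
    (hKato : ∀ (W : WeierstrassCurve ℚ) [W.IsElliptic] (p : ℕ) [Fact p.Prime],
      kato_finite_of_L_one_ne_zero W p)
    (hHP : ∀ (W : WeierstrassCurve ℚ) (K : Type) [Field K] [NumberField K],
      exists_isHeegnerPoint W K)
    (hGZ : ∀ (W : WeierstrassCurve ℚ) (N : ℕ) [NeZero N] (K : Type) [Field K] [NumberField K],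
      analyticRankEK_eq_one_iff_heegner_nonTorsion W N K)
    (h2 : nonempty_iwasawaH2Data) (h12 : thm12_4) (h31 : finite_descentCokernel_of_rankOne)
    (hEV : ThreeAdicBDPElementExistsWithValue) (hERL : ThreeAdicKatoBDPReciprocity) :
    AnalyticRankOneOfRankOneFiniteShaThree :=
  cruxB_of_namedFacts_of_prFormulaH2 hpar hmod hHL hKato hHP hGZ nonempty_iwasawaH1Data_holds h2 h12 h31
    locP_kernel_isTorsion_of_rankOne_holds (prFormulaAtThreeH2_of_bdpExistsValue_of_reciprocity hEV hERL)

/-- **The registered kato-zeta line closes from {RI, EV∃, (ERL₃)}**: crux B from the v1e 9-conjunct bundle of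
`stub_refereedInputs` (token for token: the six refereed facts ∧ `nonempty_iwasawaH2Data ∧ thm12_4 ∧
finite_descentCokernel_of_rankOne`), the BDP element with its value (EV∃) and (ERL₃) — the research stub
`stub_prFormulaAtThree : PRFormulaAtThreeH2` being supplied by `prFormulaAtThreeH2_of_bdpExistsValue_of_reciprocity`.
CONDITIONAL; closes nothing. [cite: AlpogeBhargavaShnidman2022, App. A Thm. 10.1 and §10.1.3 (pp. 33–34)] -/
theorem cruxB_of_refereedInputs_of_bdpExistsValue_of_reciprocity
    (RI : (∀ (W : WeierstrassCurve ℚ) [W.IsElliptic] (p : ℕ) [Fact p.Prime], p_parity W p) ∧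
      ModularForms.exists_isNewformOf ∧
      HoffsteinLuo1997_exists_twist_L_one_ne_zero ∧
      (∀ (W : WeierstrassCurve ℚ) [W.IsElliptic] (p : ℕ) [Fact p.Prime],
        kato_finite_of_L_one_ne_zero W p) ∧
      (∀ (W : WeierstrassCurve ℚ) (K : Type) [Field K] [NumberField K], exists_isHeegnerPoint W K) ∧
      (∀ (W : WeierstrassCurve ℚ) (N : ℕ) [NeZero N] (K : Type) [Field K] [NumberField K],
        analyticRankEK_eq_one_iff_heegner_nonTorsion W N K) ∧
      nonempty_iwasawaH2Data ∧ thm12_4 ∧ finite_descentCokernel_of_rankOne)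
    (hEV : ThreeAdicBDPElementExistsWithValue) (hERL : ThreeAdicKatoBDPReciprocity) :
    AnalyticRankOneOfRankOneFiniteShaThree :=
  cruxB_of_namedFacts_of_bdpExistsValue_of_reciprocity RI.1 RI.2.1 RI.2.2.1 RI.2.2.2.1 RI.2.2.2.2.1 RI.2.2.2.2.2.1
    RI.2.2.2.2.2.2.1 RI.2.2.2.2.2.2.2.1 RI.2.2.2.2.2.2.2.2 hEV hERL

/-- **The fully decomposed end state of S2b's crux B** (every hypothesis a named tree `Prop`): crux B ⟸ {six refereed
theorems; three reading-grade Kato facts; (T1) Hsieh 2014 Thm A at any level `hT1`; the PRINTED Tate–Sen theorem `hTS`}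
[all citation-borne] + {the archimedean value-reciprocity clause `hVR` (print-derivable shape); the ∀-frame value formula
at 𝟙 `hV` (WRITTEN); the Kato ↔ BDP reciprocity `hERL` (OPEN research)} — EV∃ by
`bdpExistsWithValue_of_anyLevel_of_descent_of_value` (p481496) over the descent reduction
`threeAdicHsiehDescent_of_tateSenCharacter_of_valueReciprocity` (p487394), then the previous census. CONDITIONAL; closes
nothing; (LB-wan) does not occur. [cite: Hsieh2014, Thm. A p. 712 = Thm. 1 (arXiv:1112.1580 pp. 3–4)]
[cite: BrinonConrad2009, Thm. 2.2.7] [cite: AlpogeBhargavaShnidman2022, App. A Thm. 10.1 and Thm. 10.8 (pp. 33–34)] -/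
theorem cruxB_of_namedFacts_of_tateSen_of_valueReciprocity_of_value_of_reciprocity
    (hpar : ∀ (W : WeierstrassCurve ℚ) [W.IsElliptic] (p : ℕ) [Fact p.Prime], p_parity W p)
    (hmod : ModularForms.exists_isNewformOf) (hHL : HoffsteinLuo1997_exists_twist_L_one_ne_zero)
    (hKato : ∀ (W : WeierstrassCurve ℚ) [W.IsElliptic] (p : ℕ) [Fact p.Prime],
      kato_finite_of_L_one_ne_zero W p)
    (hHP : ∀ (W : WeierstrassCurve ℚ) (K : Type) [Field K] [NumberField K],
      exists_isHeegnerPoint W K)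
    (hGZ : ∀ (W : WeierstrassCurve ℚ) (N : ℕ) [NeZero N] (K : Type) [Field K] [NumberField K],
      analyticRankEK_eq_one_iff_heegner_nonTorsion W N K)
    (h2 : nonempty_iwasawaH2Data) (h12 : thm12_4) (h31 : finite_descentCokernel_of_rankOne)
    (hT1 : Hsieh2014.thmA_exists_isHsiehLFunction_unrPeriod_anyLevel) (hTS : TateSenCharacterVanishing 3)
    (hVR : ThreeAdicBDPValueReciprocity) (hV : ThreeAdicBDPValueAtOne) (hERL : ThreeAdicKatoBDPReciprocity) :
    AnalyticRankOneOfRankOneFiniteShaThree :=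
  cruxB_of_namedFacts_of_bdpExistsValue_of_reciprocity hpar hmod hHL hKato hHP hGZ h2 h12 h31
    (bdpExistsWithValue_of_anyLevel_of_descent_of_value hT1
      (threeAdicHsiehDescent_of_tateSenCharacter_of_valueReciprocity hTS hVR) hV) hERL

end Summit.BirchSwinnertonDyer.BirchSwinnertonDyer.Theorems.MordellShaFreeCutRoadsMeetCensus

end
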